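import Summits.Ventures.YMGap.FlowData.RectTubeTransferOperator
import Summits.Ventures.YMGap.Census.TwistCensusObjects
import Literature.Analysis.OperatorTheory.PositiveKernelNormLogConvex
import Literature.MathematicalPhysics.QuantumLattice.SU2Haar
import HarnessLib

/-!
# Venture YMGap, track Y3 FLOW-DATA — the MAGNETICALLY TWISTED tube operator `T_ζ` and the 't Hooft magnetic-flux
# energy `E_mag(ζ) = log ‖T‖ − log ‖T_ζ‖` of a rectangular tube (FLOW-PLAN O6) — DEFINITIONS + first theorems

HONEST FRAMING: venture file of the cell `pub-ymgap` (QuantumFields programme), track Y3 (FLOW-DATA).  It TYPES the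
object of the FLOW-TABLE's «magnetic-flux rows» (FLOW-PLAN O6: one spatial plaquette of every time slice carries the
twisted weight `exp(β(−½ Tr U_p − 1))`, `E_mag := −ln(λ̂₀_tw/λ̂₀)`): for a centre-valued plaquette field `ζ` the
magnetic sum `Σ_q Re tr ρ(ζ_q · U_q)`, the twisted slice kernel and operator `T_ζ`, and `E_mag(ζ)`.  Finite spatial
torus, time extent infinite (operator norms); no number, no row, nothing about `L → ∞`, the continuum or a mass gap.
The SIGN `E_mag ≥ 0` (Tomboulis–Yaffe type) is NOT claimed here.

* `rectMagSumTw ρ ζ` (plaquettes = the tree's `Census.RectPlaquette` / `rectPlaquetteHolonomy`), `rectSliceKernelTw ρ ζ J_E J_M`,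
  `rectTubeTwistedOperator ρ J Ls ζ`, `rectMagneticFluxEnergy ρ J Ls ζ`; `ζ ≡ 1` is the untwisted object (`rectSliceKernelTw_one`, `rectTubeTwistedOperator_one`,
  `rectMagneticFluxEnergy_one`); kernel continuous / `> 0` / bounded / symmetric, `T_ζ` self-adjoint, compact,
  positivity improving, `‖T_ζ‖ > 0`;
* **`abs_rectMagneticFluxEnergy_le`** — the crude window `|E_mag(ζ)| ≤ 2·|J|·n·#S` if `ζ = 1` off the plaquette set `S`
  (monotonicity of positive-kernel norms); the cell's `SU(2)` object `su2RectMagneticFluxEnergy β Ls S` (`ζ = −1` on `S`):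
  `su2RectMagneticFluxEnergy_empty`, **`abs_su2RectMagneticFluxEnergy_le`** `|E_mag| ≤ 2|β|·#S`.
Companions (theorems only): `RectTubeCentreRescaling` (centre rescalings, kernel conjugation), `RectTubeMagneticTwistCoboundary`
(`E_mag(ζ·U(γ)) = E_mag(ζ)` for central link fields `γ`: the twist is a class modulo coboundaries, as for 't Hooft's flux).

References: G. 't Hooft, Nucl. Phys. B 153 (1979) 141 [cite: tHooft1979Flux]; E. T. Tomboulis, L. G. Yaffe, Commun. Math.
Phys. 100 (1985) 313 [cite: TomboulisYaffe1985]; M. Lüscher, Commun. Math. Phys. 54 (1977) 283 [cite: Luscher1977];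
I. Montvay, G. Münster (1994) §3.2.6 [cite: MontvayMunster1994, §3.2.6].
-/

noncomputable section

open scoped BigOperators ENNReal
open MeasureTheory Filter Function
open Literature.MathematicalPhysics.QuantumFieldTheory Literature.Analysis.OperatorTheory
open Literature.MathematicalPhysics.QuantumLattice (RectTorusSite fundamentalRep continuous_fundamentalRep
  fundamentalRep_mem_unitaryGroup)
open Literature.Barriers.QuantumFields
open Summit.Ventures.YMGap.Census (RectPlaquette rectPlaquetteHolonomy)

namespace Summit.Ventures.YMGap.FlowData

/-! ### The twisted magnetic sum and slice kernel -/

section Twisted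

variable {k : ℕ} {Ls : Fin k → ℕ} {G : Type*} {n : ℕ} [Group G] (ρ : G →* Matrix (Fin n) (Fin n) ℂ)

/-- The plaquette holonomy (the tree's `Census.rectPlaquetteHolonomy`, a slice being a `RectGaugeConfig`) depends
continuously on the slice. [folklore] -/
theorem continuous_rectPlaquetteHolonomy [TopologicalSpace G] [IsTopologicalGroup G] (x : RectTorusSite Ls) (i j : Fin k) :
    Continuous fun a : RectSlice Ls G => rectPlaquetteHolonomy a x i j := by
  have hc : ∀ e : RectTorusSite Ls × Fin k, Continuous fun a : RectSlice Ls G => a e := fun e => continuous_apply e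
  unfold rectPlaquetteHolonomy
  exact (((hc _).mul (hc _)).mul (hc _).inv).mul (hc _).inv

variable [∀ i, NeZero (Ls i)]

/-- The **twisted magnetic plaquette sum** `Σ_q Re tr ρ(ζ_q · U_q)` for a plaquette field `ζ` (intended central:
't Hooft's twist `ζ_q ∈ Z(G)`; `ζ ≡ 1` is the Wilson magnetic sum `rectMagSum`). [cite: tHooft1979Flux] -/
def rectMagSumTw (ζ : RectPlaquette Ls → G) (a : RectSlice Ls G) : ℝ :=
  ∑ x : RectTorusSite Ls, ∑ p : {p : Fin k × Fin k // p.1 < p.2},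
    (ρ (ζ (x, p) * rectPlaquetteHolonomy a x p.1.1 p.1.2)).trace.re

/-- `ζ ≡ 1` gives the tree's `rectMagSum`. [folklore] -/
theorem rectMagSumTw_one (a : RectSlice Ls G) : rectMagSumTw ρ 1 a = rectMagSum ρ a := by
  unfold rectMagSumTw rectMagSum rectPlaquetteHolonomy
  simp only [Pi.one_apply, one_mul]

/-- **`|magTw_ζ(a) − mag(a)| ≤ 2 n · #S`** when `ζ = 1` off the plaquette set `S` (unitary `ρ`: every `|Re tr ρ| ≤ n`).
[folklore] -/
theorem abs_rectMagSumTw_sub_le (hρu : ∀ g, ρ g ∈ Matrix.unitaryGroup (Fin n) ℂ) {ζ : RectPlaquette Ls → G}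
    {S : Finset (RectPlaquette Ls)} (hζ : ∀ q, q ∉ S → ζ q = 1) (a : RectSlice Ls G) :
    |rectMagSumTw ρ ζ a - rectMagSum ρ a| ≤ 2 * n * S.card := by
  classical
  have htr : ∀ g : G, |(ρ g).trace.re| ≤ n := fun g =>
    (Complex.abs_re_le_norm _).trans (FiniteTemperature.norm_trace_le_of_mem_unitaryGroup (hρu _))
  rw [← rectMagSumTw_one ρ a]
  unfold rectMagSumTw
  rw [← Finset.sum_sub_distrib]
  simp_rw [← Finset.sum_sub_distrib]
  rw [← Fintype.sum_prod_type' (f := fun x p => (ρ (ζ (x, p) * rectPlaquetteHolonomy a x p.1.1 p.1.2)).trace.re -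
    (ρ ((1 : RectPlaquette Ls → G) (x, p) * rectPlaquetteHolonomy a x p.1.1 p.1.2)).trace.re)]
  have hd : ∀ q : RectPlaquette Ls, |(ρ (ζ q * rectPlaquetteHolonomy a q.1 q.2.1.1 q.2.1.2)).trace.re -
      (ρ ((1 : RectPlaquette Ls → G) q * rectPlaquetteHolonomy a q.1 q.2.1.1 q.2.1.2)).trace.re| ≤
        if q ∈ S then 2 * (n : ℝ) else 0 := by
    intro q
    split_ifs with hq
    · have h1 := abs_le.1 (htr (ζ q * rectPlaquetteHolonomy a q.1 q.2.1.1 q.2.1.2))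
      have h2 := abs_le.1 (htr ((1 : RectPlaquette Ls → G) q * rectPlaquetteHolonomy a q.1 q.2.1.1 q.2.1.2))
      rw [abs_le]; constructor <;> linarith [h1.1, h1.2, h2.1, h2.2]
    · rw [hζ q hq, Pi.one_apply, sub_self, abs_zero]
  refine (Finset.abs_sum_le_sum_abs _ _).trans ((Finset.sum_le_sum fun q _ => hd q).trans (le_of_eq ?_))
  rw [Finset.sum_ite_mem, Finset.univ_inter, Finset.sum_const, nsmul_eq_mul]
  ring

variable [TopologicalSpace G] [IsTopologicalGroup G]

/-- `rectMagSumTw` is continuous (continuous `ρ`). [folklore] -/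
theorem continuous_rectMagSumTw (hρ : Continuous ρ) (ζ : RectPlaquette Ls → G) :
    Continuous (rectMagSumTw (Ls := Ls) ρ ζ) := by
  have htr : Continuous fun g : G => (ρ g).trace.re := Complex.continuous_re.comp (Continuous.matrix_trace hρ)
  unfold rectMagSumTw
  exact continuous_finsetSum _ fun x _ => continuous_finsetSum _ fun p _ =>
    htr.comp (continuous_const.mul (continuous_rectPlaquetteHolonomy x p.1.1 p.1.2))

variable [CompactSpace G] [MeasurableSpace G] [BorelSpace G]

/-- The **twisted slice kernel** `K_ζ(a,b) = e^{J_M magTw_ζ(a)/2} (∫ e^{J_E elec(a,E,b)} dE) e^{J_M magTw_ζ(b)/2}`: the Wilson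
time-slice kernel with the plaquette weights of one slice twisted by `ζ`. [cite: tHooft1979Flux] [cite: MontvayMunster1994, §3.2.6] -/
def rectSliceKernelTw (ζ : RectPlaquette Ls → G) (JE JM : ℝ) (a b : RectSlice Ls G) : ℝ :=
  Real.exp (JM / 2 * rectMagSumTw ρ ζ a) *
    (∫ E, Real.exp (JE * rectElecSum ρ a E b) ∂(Measure.pi fun _ : RectTorusSite Ls => haarProbability G)) *
    Real.exp (JM / 2 * rectMagSumTw ρ ζ b)

/-- `ζ ≡ 1` gives the tree's `rectSliceKernel`. [folklore] -/
theorem rectSliceKernelTw_one (JE JM : ℝ) (a b : RectSlice Ls G) :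
    rectSliceKernelTw ρ 1 JE JM a b = rectSliceKernel ρ JE JM a b := by
  unfold rectSliceKernelTw rectSliceKernel
  rw [rectMagSumTw_one, rectMagSumTw_one]

/-- **`K_ζ = e^{J_M(magTw_ζ − mag)(a)/2} · K · e^{J_M(magTw_ζ − mag)(b)/2}`**. [folklore] -/
theorem rectSliceKernelTw_eq_mul (ζ : RectPlaquette Ls → G) (JE JM : ℝ) (a b : RectSlice Ls G) :
    rectSliceKernelTw ρ ζ JE JM a b =
      Real.exp (JM / 2 * (rectMagSumTw ρ ζ a - rectMagSum ρ a)) * rectSliceKernel ρ JE JM a b *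
        Real.exp (JM / 2 * (rectMagSumTw ρ ζ b - rectMagSum ρ b)) := by
  have h : ∀ c : RectSlice Ls G, Real.exp (JM / 2 * rectMagSumTw ρ ζ c) =
      Real.exp (JM / 2 * (rectMagSumTw ρ ζ c - rectMagSum ρ c)) * Real.exp (JM / 2 * rectMagSum ρ c) := by
    intro c; rw [← Real.exp_add]; congr 1; ring
  unfold rectSliceKernelTw rectSliceKernel
  rw [h, h]; ring

variable [SecondCountableTopology G]

/-- The twisted kernel is jointly continuous (continuous `ρ`). [folklore] -/
theorem continuous_rectSliceKernelTw (hρ : Continuous ρ) (ζ : RectPlaquette Ls → G) (JE JM : ℝ) :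
    Continuous (uncurry (rectSliceKernelTw (Ls := Ls) ρ ζ JE JM)) := by
  have hd : Continuous fun c : RectSlice Ls G => Real.exp (JM / 2 * (rectMagSumTw ρ ζ c - rectMagSum ρ c)) :=
    (continuous_const.mul ((continuous_rectMagSumTw ρ hρ ζ).sub (continuous_rectMagSum ρ hρ))).rexp
  have h : uncurry (rectSliceKernelTw (Ls := Ls) ρ ζ JE JM) = fun z : RectSlice Ls G × RectSlice Ls G =>
      Real.exp (JM / 2 * (rectMagSumTw ρ ζ z.1 - rectMagSum ρ z.1)) * uncurry (rectSliceKernel (Ls := Ls) ρ JE JM) z *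
        Real.exp (JM / 2 * (rectMagSumTw ρ ζ z.2 - rectMagSum ρ z.2)) := by
    funext z; exact rectSliceKernelTw_eq_mul ρ ζ JE JM z.1 z.2
  rw [h]
  exact ((hd.comp continuous_fst).mul (continuous_rectSliceKernel ρ hρ JE JM)).mul (hd.comp continuous_snd)

/-- The twisted kernel is strictly positive. [folklore] -/
theorem rectSliceKernelTw_pos (hρ : Continuous ρ) (ζ : RectPlaquette Ls → G) (JE JM : ℝ) (a b : RectSlice Ls G) :
    0 < rectSliceKernelTw ρ ζ JE JM a b := by
  rw [rectSliceKernelTw_eq_mul]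
  exact mul_pos (mul_pos (Real.exp_pos _) (rectSliceKernel_pos ρ hρ JE JM a b)) (Real.exp_pos _)

/-- The twisted kernel is bounded. [folklore] -/
theorem exists_rectSliceKernelTw_le (hρ : Continuous ρ) (ζ : RectPlaquette Ls → G) (JE JM : ℝ) :
    ∃ C : ℝ, ∀ a b : RectSlice Ls G, ‖rectSliceKernelTw ρ ζ JE JM a b‖ ≤ C := by
  obtain ⟨C, hC⟩ := isCompact_univ.exists_bound_of_continuousOn (continuous_rectSliceKernelTw ρ hρ ζ JE JM).continuousOn
  exact ⟨C, fun a b => hC (a, b) (Set.mem_univ _)⟩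

/-- The twisted kernel is jointly strongly measurable. [folklore] -/
theorem stronglyMeasurable_rectSliceKernelTw (hρ : Continuous ρ) (ζ : RectPlaquette Ls → G) (JE JM : ℝ) :
    StronglyMeasurable (uncurry (rectSliceKernelTw (Ls := Ls) ρ ζ JE JM)) :=
  (continuous_rectSliceKernelTw ρ hρ ζ JE JM).stronglyMeasurable

omit [SecondCountableTopology G] in
/-- The twisted kernel is symmetric (unitary `ρ`). [folklore] -/
theorem rectSliceKernelTw_symm (hρu : ∀ g, ρ g ∈ Matrix.unitaryGroup (Fin n) ℂ) (ζ : RectPlaquette Ls → G) (JE JM : ℝ)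
    (a b : RectSlice Ls G) : rectSliceKernelTw ρ ζ JE JM a b = rectSliceKernelTw ρ ζ JE JM b a := by
  rw [rectSliceKernelTw_eq_mul, rectSliceKernelTw_eq_mul, rectSliceKernel_symm ρ hρu]; ring

end Twisted

/-! ### The twisted operator and the magnetic-flux energy -/

section Operator

variable {G : Type*} [Group G] [TopologicalSpace G] [IsTopologicalGroup G] [CompactSpace G]
  [MeasurableSpace G] [BorelSpace G] {n k : ℕ} (ρ : G →* Matrix (Fin n) (Fin n) ℂ) (J : ℝ) (Ls : Fin k → ℕ)
  [∀ i, NeZero (Ls i)]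

/-- **The magnetically twisted tube operator `T_ζ`**: the bounded operator on `L²(rectSliceMeasure)` with kernel
`rectSliceKernelTw ρ ζ J J` (junk `0` unless the kernel is jointly strongly measurable and bounded — automatic for continuous
`ρ`, second-countable `G`).  FLOW-PLAN O6's `T̂_tw` is `ζ = −1` on one plaquette. [cite: tHooft1979Flux] -/
def rectTubeTwistedOperator (ζ : RectPlaquette Ls → G) :
    Lp ℝ 2 (rectSliceMeasure G Ls) →L[ℝ] Lp ℝ 2 (rectSliceMeasure G Ls) := by
  classical
  exact if h : StronglyMeasurable (uncurry (rectSliceKernelTw (Ls := Ls) ρ ζ J J)) ∧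
      ∃ C : ℝ, ∀ a b : RectSlice Ls G, ‖rectSliceKernelTw ρ ζ J J a b‖ ≤ C then
    Classical.choose (exists_kernelOp (μ := rectSliceMeasure G Ls) h.1 h.2.choose_spec)
  else 0

/-- **The magnetic-flux energy `E_mag(ζ) = log ‖T‖ − log ‖T_ζ‖`** of the rectangular tube (FLOW-PLAN O6 `−ln(λ̂₀_tw/λ̂₀)`;
the common normalisation of `T̂` cancels in the ratio). [cite: tHooft1979Flux] -/
def rectMagneticFluxEnergy (ζ : RectPlaquette Ls → G) : ℝ :=
  Real.log ‖rectTubeTransferOperator ρ J Ls‖ - Real.log ‖rectTubeTwistedOperator ρ J Ls ζ‖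

variable {ρ J Ls} [SecondCountableTopology G]

/-- The kernel formula `(T_ζ φ)(a) = ∫ K_ζ(a, b) φ(b) db` a.e. (continuous `ρ`). [folklore] -/
theorem rectTubeTwistedOperator_ae_eq (hρ : Continuous ρ) (ζ : RectPlaquette Ls → G) (φ : Lp ℝ 2 (rectSliceMeasure G Ls)) :
    (rectTubeTwistedOperator ρ J Ls ζ φ : RectSlice Ls G → ℝ) =ᵐ[rectSliceMeasure G Ls]
      fun a => ∫ b, rectSliceKernelTw ρ ζ J J a b * φ b ∂(rectSliceMeasure G Ls) := by
  classical
  have h : StronglyMeasurable (uncurry (rectSliceKernelTw (Ls := Ls) ρ ζ J J)) ∧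
      ∃ C : ℝ, ∀ a b : RectSlice Ls G, ‖rectSliceKernelTw ρ ζ J J a b‖ ≤ C :=
    ⟨stronglyMeasurable_rectSliceKernelTw ρ hρ ζ J J, exists_rectSliceKernelTw_le ρ hρ ζ J J⟩
  unfold rectTubeTwistedOperator
  rw [dif_pos h]
  exact Classical.choose_spec (exists_kernelOp (μ := rectSliceMeasure G Ls) h.1 h.2.choose_spec) φ

/-- **`T_1 = T`**: the untwisted object is the tree's tube transfer operator. [folklore] -/
theorem rectTubeTwistedOperator_one (hρ : Continuous ρ) : rectTubeTwistedOperator ρ J Ls 1 = rectTubeTransferOperator ρ J Ls := by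
  refine ContinuousLinearMap.ext fun φ => Lp.ext ((rectTubeTwistedOperator_ae_eq hρ 1 φ).trans ?_)
  refine EventuallyEq.trans (Eventually.of_forall fun a => ?_) (rectTubeTransferOperator_ae_eq J Ls hρ φ).symm
  simp only [rectSliceKernelTw_one]

/-- `T_ζ` is self-adjoint (unitary `ρ`). [folklore] -/
theorem isSelfAdjoint_rectTubeTwistedOperator (hρ : Continuous ρ) (hρu : ∀ g, ρ g ∈ Matrix.unitaryGroup (Fin n) ℂ)
    (ζ : RectPlaquette Ls → G) : IsSelfAdjoint (rectTubeTwistedOperator ρ J Ls ζ) := by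
  obtain ⟨C, hC⟩ := exists_rectSliceKernelTw_le (Ls := Ls) ρ hρ ζ J J
  exact isSelfAdjoint_kernelOp (stronglyMeasurable_rectSliceKernelTw ρ hρ ζ J J) hC
    (rectSliceKernelTw_symm ρ hρu ζ J J) (rectTubeTwistedOperator_ae_eq hρ ζ)

/-- `T_ζ` is compact. [folklore] -/
theorem isCompactOperator_rectTubeTwistedOperator (hρ : Continuous ρ) (ζ : RectPlaquette Ls → G) :
    IsCompactOperator (rectTubeTwistedOperator ρ J Ls ζ) := by
  obtain ⟨C, hC⟩ := exists_rectSliceKernelTw_le (Ls := Ls) ρ hρ ζ J J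
  exact isCompactOperator_kernelOp hC ((norm_nonneg _).trans (hC 1 1)) (rectTubeTwistedOperator_ae_eq hρ ζ)

/-- `T_ζ` is positivity improving (the twisted weight is still a positive function). [folklore] -/
theorem isPositivityImproving_rectTubeTwistedOperator (hρ : Continuous ρ) (ζ : RectPlaquette Ls → G) :
    IsPositivityImproving (rectTubeTwistedOperator ρ J Ls ζ) := by
  obtain ⟨C, hC⟩ := exists_rectSliceKernelTw_le (Ls := Ls) ρ hρ ζ J J
  exact isPositivityImproving_kernelOp (stronglyMeasurable_rectSliceKernelTw ρ hρ ζ J J) hC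
    (rectSliceKernelTw_pos ρ hρ ζ J J) (rectTubeTwistedOperator_ae_eq hρ ζ)

/-- `0 < ‖T_ζ‖`. [folklore] -/
theorem norm_rectTubeTwistedOperator_pos (hρ : Continuous ρ) (ζ : RectPlaquette Ls → G) :
    0 < ‖rectTubeTwistedOperator ρ J Ls ζ‖ := by
  obtain ⟨C, hC⟩ := exists_rectSliceKernelTw_le (Ls := Ls) ρ hρ ζ J J
  exact norm_pos_iff.2 (kernelOp_ne_zero (stronglyMeasurable_rectSliceKernelTw ρ hρ ζ J J) hC
    (rectSliceKernelTw_pos ρ hρ ζ J J) (IsProbabilityMeasure.ne_zero _) (rectTubeTwistedOperator_ae_eq hρ ζ))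

/-- `E_mag(1) = 0`. [folklore] -/
theorem rectMagneticFluxEnergy_one (hρ : Continuous ρ) : rectMagneticFluxEnergy ρ J Ls 1 = 0 := by
  unfold rectMagneticFluxEnergy
  rw [rectTubeTwistedOperator_one hρ, sub_self]

end Operator

/-! ### The crude window `|E_mag| ≤ 2 |J| n #S` -/

section Window

variable {G : Type*} [Group G] [TopologicalSpace G] [IsTopologicalGroup G] [CompactSpace G]
  [MeasurableSpace G] [BorelSpace G] [SecondCountableTopology G] {n k : ℕ} (ρ : G →* Matrix (Fin n) (Fin n) ℂ)
  {J : ℝ} {Ls : Fin k → ℕ} [∀ i, NeZero (Ls i)]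

/-- **`|log ‖T_ζ‖ − log ‖T‖| ≤ 2 |J| n · #S`** when `ζ = 1` off `S` (continuous unitary `ρ`): pointwise
`e^{−2|J| n #S} K ≤ K_ζ ≤ e^{2|J| n #S} K` and monotonicity of positive-kernel norms. [folklore] -/
theorem abs_rectMagneticFluxEnergy_le (hρ : Continuous ρ) (hρu : ∀ g, ρ g ∈ Matrix.unitaryGroup (Fin n) ℂ)
    {ζ : RectPlaquette Ls → G} {S : Finset (RectPlaquette Ls)} (hζ : ∀ q, q ∉ S → ζ q = 1) :
    |rectMagneticFluxEnergy ρ J Ls ζ| ≤ 2 * |J| * n * S.card := by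
  set c : ℝ := 2 * |J| * n * S.card with hc
  set w : ℝ := Real.exp (-c) with hw
  have hwpos : 0 < w := Real.exp_pos _
  set K := rectSliceKernel (Ls := Ls) ρ J J with hK
  set K' := rectSliceKernelTw (Ls := Ls) ρ ζ J J with hK'
  -- pointwise two-sided comparison `w K ≤ K_ζ`, `w K_ζ ≤ K`
  have hΔ : ∀ a : RectSlice Ls G, |J / 2 * (rectMagSumTw ρ ζ a - rectMagSum ρ a)| ≤ c / 2 := by
    intro a
    rw [abs_mul, abs_div, abs_two, hc]
    calc |J| / 2 * |rectMagSumTw ρ ζ a - rectMagSum ρ a| ≤ |J| / 2 * (2 * n * S.card) :=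
          mul_le_mul_of_nonneg_left (abs_rectMagSumTw_sub_le ρ hρu hζ a) (by positivity)
      _ = 2 * |J| * n * S.card / 2 := by ring
  have hpt : ∀ a b, w * K a b ≤ K' a b ∧ w * K' a b ≤ K a b := by
    intro a b
    have hKpos : 0 < K a b := rectSliceKernel_pos ρ hρ J J a b
    have hprod : K' a b = Real.exp (J / 2 * (rectMagSumTw ρ ζ a - rectMagSum ρ a) +
        J / 2 * (rectMagSumTw ρ ζ b - rectMagSum ρ b)) * K a b := by
      rw [hK', rectSliceKernelTw_eq_mul, ← hK, Real.exp_add]; ring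
    have ha := abs_le.1 (hΔ a)
    have hb := abs_le.1 (hΔ b)
    rw [hprod, hw]
    constructor
    · exact mul_le_mul_of_nonneg_right (Real.exp_le_exp.2 (by linarith [ha.1, hb.1])) hKpos.le
    · rw [← mul_assoc, ← Real.exp_add]
      calc _ ≤ Real.exp 0 * K a b := mul_le_mul_of_nonneg_right (Real.exp_le_exp.2 (by linarith [ha.2, hb.2])) hKpos.le
        _ = K a b := by rw [Real.exp_zero, one_mul]
  -- scaled operators have scaled kernels
  have hsm : ∀ {Kx : RectSlice Ls G → RectSlice Ls G → ℝ} {A : Lp ℝ 2 (rectSliceMeasure G Ls) →L[ℝ] Lp ℝ 2 (rectSliceMeasure G Ls)},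
      (∀ φ, (A φ : RectSlice Ls G → ℝ) =ᵐ[rectSliceMeasure G Ls] fun x => ∫ y, Kx x y * φ y ∂(rectSliceMeasure G Ls)) →
      ∀ φ : Lp ℝ 2 (rectSliceMeasure G Ls), ((w • A) φ : RectSlice Ls G → ℝ) =ᵐ[rectSliceMeasure G Ls]
        fun x => ∫ y, (w * Kx x y) * φ y ∂(rectSliceMeasure G Ls) := by
    intro Kx A hA φ
    filter_upwards [Lp.coeFn_smul w (A φ), hA φ] with x hx hT
    rw [_root_.smul_apply, hx, Pi.smul_apply, hT, smul_eq_mul, ← integral_const_mul]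
    refine integral_congr_ae (Eventually.of_forall fun y => ?_)
    ring
  have hKm : StronglyMeasurable (uncurry K) := stronglyMeasurable_uncurry_rectSliceKernel ρ hρ J J
  have hK'm : StronglyMeasurable (uncurry K') := stronglyMeasurable_rectSliceKernelTw ρ hρ ζ J J
  have hwKm : StronglyMeasurable (uncurry fun x y => w * K x y) := stronglyMeasurable_const.mul hKm
  have hwK'm : StronglyMeasurable (uncurry fun x y => w * K' x y) := stronglyMeasurable_const.mul hK'm
  obtain ⟨C, hC⟩ := exists_rectSliceKernel_le (Ls := Ls) ρ hρ J J
  obtain ⟨C', hC'⟩ := exists_rectSliceKernelTw_le (Ls := Ls) ρ hρ ζ J J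
  have hwb : ∀ {Kx : RectSlice Ls G → RectSlice Ls G → ℝ} {D : ℝ}, (∀ x y, ‖Kx x y‖ ≤ D) →
      ∀ x y, ‖w * Kx x y‖ ≤ ‖w‖ * D := fun hD x y => by
    rw [norm_mul]; exact mul_le_mul_of_nonneg_left (hD x y) (norm_nonneg _)
  have hTpos : 0 < ‖rectTubeTransferOperator ρ J Ls‖ := norm_rectTubeTransferOperator_pos J Ls hρ
  have hT'pos : 0 < ‖rectTubeTwistedOperator ρ J Ls ζ‖ := norm_rectTubeTwistedOperator_pos hρ ζ
  have h1 : ‖w • rectTubeTransferOperator ρ J Ls‖ ≤ ‖rectTubeTwistedOperator ρ J Ls ζ‖ :=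
    norm_kernelOp_mono (μ := rectSliceMeasure G Ls) hK'm hC' hwKm (hwb hC)
      (fun x y => mul_nonneg hwpos.le (rectSliceKernel_pos ρ hρ J J x y).le) (fun x y => (hpt x y).1)
      (rectTubeTwistedOperator_ae_eq hρ ζ) (hsm (rectTubeTransferOperator_ae_eq J Ls hρ))
  have h2 : ‖w • rectTubeTwistedOperator ρ J Ls ζ‖ ≤ ‖rectTubeTransferOperator ρ J Ls‖ :=
    norm_kernelOp_mono (μ := rectSliceMeasure G Ls) hKm hC hwK'm (hwb hC')
      (fun x y => mul_nonneg hwpos.le (rectSliceKernelTw_pos ρ hρ ζ J J x y).le) (fun x y => (hpt x y).2)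
      (rectTubeTransferOperator_ae_eq J Ls hρ) (hsm (rectTubeTwistedOperator_ae_eq hρ ζ))
  rw [norm_smul, Real.norm_eq_abs, abs_of_pos hwpos] at h1 h2
  have hl1 := Real.log_le_log (mul_pos hwpos hTpos) h1
  have hl2 := Real.log_le_log (mul_pos hwpos hT'pos) h2
  rw [Real.log_mul hwpos.ne' hTpos.ne', hw, Real.log_exp] at hl1
  rw [Real.log_mul hwpos.ne' hT'pos.ne', hw, Real.log_exp] at hl2
  unfold rectMagneticFluxEnergy
  rw [abs_le]; constructor <;> linarith

end Window

/-! ### The cell's object: `SU(2)`, fundamental representation, `ζ = −1` on a plaquette set `S`, `J = β_W/2` -/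

section SU2

variable {k : ℕ}

/-- The `SU(2)` plaquette twist of a plaquette set `S`: `−1` on `S`, `1` elsewhere. -/
def su2PlaquetteTwist {Ls : Fin k → ℕ} (S : Finset (RectPlaquette Ls)) :
    RectPlaquette Ls → Matrix.specialUnitaryGroup (Fin 2) ℂ := by
  classical
  exact fun q => if q ∈ S then su2MinusOne else 1

/-- Off `S` the twist is trivial. [folklore] -/
theorem su2PlaquetteTwist_of_not_mem {Ls : Fin k → ℕ} {S : Finset (RectPlaquette Ls)} (q : RectPlaquette Ls) (hq : q ∉ S) :
    su2PlaquetteTwist S q = 1 := by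
  unfold su2PlaquetteTwist
  exact if_neg hq

/-- **The cell's twisted tube operator** `T̂_tw` un-normalised: `SU(2)`, fundamental, Wilson coupling `β` (`J = β/2`), the
plaquettes of `S` of every slice carrying `exp(β·½Tr(−U_p))`. -/
def su2RectTwistedOperator (β : ℝ) (Ls : Fin k → ℕ) [∀ i, NeZero (Ls i)] (S : Finset (RectPlaquette Ls)) :
    Lp ℝ 2 (rectSliceMeasure (Matrix.specialUnitaryGroup (Fin 2) ℂ) Ls) →L[ℝ]
      Lp ℝ 2 (rectSliceMeasure (Matrix.specialUnitaryGroup (Fin 2) ℂ) Ls) :=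
  rectTubeTwistedOperator (fundamentalRep (Fin 2)) (β / 2) Ls (su2PlaquetteTwist S)

/-- **The cell's magnetic-flux energy `E_mag(β; Π_i ℤ/(Ls i); S) = log ‖T‖ − log ‖T_S‖`** (FLOW-PLAN O6: `S` = one plaquette). -/
def su2RectMagneticFluxEnergy (β : ℝ) (Ls : Fin k → ℕ) [∀ i, NeZero (Ls i)] (S : Finset (RectPlaquette Ls)) : ℝ :=
  rectMagneticFluxEnergy (fundamentalRep (Fin 2)) (β / 2) Ls (su2PlaquetteTwist S)

/-- No twisted plaquette: `E_mag = 0`. [folklore] -/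
theorem su2RectMagneticFluxEnergy_empty (β : ℝ) (Ls : Fin k → ℕ) [∀ i, NeZero (Ls i)] :
    su2RectMagneticFluxEnergy β Ls ∅ = 0 := by
  haveI : SecondCountableTopology (Matrix.specialUnitaryGroup (Fin 2) ℂ) :=
    Literature.MathematicalPhysics.QuantumLattice.secondCountableTopology_su2
  have h1 : su2PlaquetteTwist (Ls := Ls) ∅ = 1 := funext fun q => su2PlaquetteTwist_of_not_mem q (Finset.notMem_empty q)
  unfold su2RectMagneticFluxEnergy
  rw [h1]
  exact rectMagneticFluxEnergy_one (continuous_fundamentalRep (Fin 2))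

/-- **The `SU(2)` window `|E_mag(β; Ls; S)| ≤ 2 |β| · #S`**: every FLOW-TABLE magnetic-flux cell (one twisted plaquette)
lies in `[−2β, 2β]`.  Finite volume only; the sign is not claimed. [folklore] -/
theorem abs_su2RectMagneticFluxEnergy_le (β : ℝ) (Ls : Fin k → ℕ) [∀ i, NeZero (Ls i)] (S : Finset (RectPlaquette Ls)) :
    |su2RectMagneticFluxEnergy β Ls S| ≤ 2 * |β| * S.card := by
  haveI : SecondCountableTopology (Matrix.specialUnitaryGroup (Fin 2) ℂ) :=
    Literature.MathematicalPhysics.QuantumLattice.secondCountableTopology_su2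
  have h := abs_rectMagneticFluxEnergy_le (fundamentalRep (Fin 2)) (J := β / 2) (Ls := Ls)
    (continuous_fundamentalRep (Fin 2)) fundamentalRep_mem_unitaryGroup
    (fun q hq => su2PlaquetteTwist_of_not_mem (S := S) q hq)
  have h2 : |β / 2| = |β| / 2 := by rw [abs_div, abs_two]
  rw [h2] at h
  unfold su2RectMagneticFluxEnergy
  push_cast at h
  linarith

end SU2

end Summit.Ventures.YMGap.FlowData
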